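import Summits.QuantumFields.BalabanUV.Beta.GAN24.SpureUnitDrift
import Summits.QuantumFields.BalabanUV.Beta.GAN24.SecondOrderLipschitzW2

/-!
# `BalabanUV.Beta.GAN24.WSlotCauchyOfShapes` — binder row G-an2-4 / (CONV-C), W-slot: the wall's CAUCHY (all-scales) SECOND-ORDER binder
# `hWall` for an2's family `BalabanStepW2.WbalOf` PROVED AS A FUNCTION OF the K-slot (`UnitDecayK ∧ CauchyDecayK` = `ConvCKWall`),
# «E3Shape» ∧ «E3Drift», and the TWO located shapes «T2Shape» ∧ «T2Drift» of the normalised bi-stencil binder tables — the W-slot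
# END-AS-FUNCTION, Cauchy half (the W-analogue of gan24-p1's `StencilSlotCauchyOfShapes.hSall_of_shapes`)

NOT IN PRINT; OUR PROOF ATTEMPT (G-an2-4 formalisation swarm, idle leaf seat `b2b-balaban-gan24-formalise-leaf-07`, gen 11; module name
PROVISIONAL — the row owner gan24-p1 / the (P4) author an2 may rename or re-home it).  HONEST FRAMING (cell contract, verbatim): «discharging
`BetaPertH` makes Bałaban's UV stability UNCONDITIONAL — a real constructive-QFT result; it is NOT the continuum limit and NOT the Clay problem.»
HONEST DEPENDENCY (verbatim): «continuum YM on T⁴ ⇐ BetaPertH ∧ nine spine estimates (0/9 proved); BetaPertH ⇐ (D1) ∧ (D4) ∧ CAP+tail;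
G-an2-4 gates asym, D1 and NE2/3/4.»  [folklore] composition, every input BY NAME: an4's `SecondOrderUnits.unitW_WbalOf` (the normalised
member `j` IS `W2SymOfK` over the normalised kernel and tables), the `j`-FREE multiplier / mixed slots `WSlotOfShapes.unitM_M1_eq` /
`unitM₂_M2Of_eq`, the normalised first field table's shape `WSlotOfShapes.locStencil_unitS_Spure` and drift `SpureUnitDrift.spureDrift_of_shapes`
(leaf-10, from «E3Shape» ∧ «E3Drift»), and leaf-03's LIPSCHITZ ESTIMATE of the carrier (`SecondOrderLipschitzW2.vertexFamily₂_W2SymOfK_sub`,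
constant `LW2` linear in the five deviations — here the multiplier and mixed deviations are `0`) applied ONCE to each pair of members `(k+j, k)` at ONE fixed rate — no induction in `j`, no per-level rate loss.
No estimate beyond that, no cited fact, no `def`, no `Prop` mirror.
NOTHING of the wall is discharged unconditionally: `hWall` is concluded FROM «T2Shape» ∧ «T2Drift» (the `j`-uniform `LocStencil₂` locality and
the geometric all-scales drift of the NORMALISED bi-stencil binder tables `unitS₂ (sfStep Lc j) (smStep d Lc j) (T₂ j)` — for an2's Stage-B
`T2Of` the recursive value 4-jet: NOT IN PRINT, OPEN, asserted nowhere), «E3Shape» ∧ «E3Drift», the K-slot rows and the mixed table's shape.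
The S-rows and the identification are untouched.  K 2/2, S 2/2 wall binders are tree theorems at `d = 3`, `Lc ≥ 2`
(`KSlotAssembly.convCKWall_holds`; `StencilSlotSAllThree.hS_hSall_three`), W 2/2 AT THE DISPLAYED PIN `cE₂ = +Lc^(2(3+1))` at every box root
(`WSlotT2Tables.hW_hWall_three_an1_pinned`, `WSlotT2TablesAn1.hW_hWall_three_an1At_pinned`) and W 0/2 for the `BetaPertH` wall literal until
(P6)/(R45) — accounting of record ref2 r89 R89-1; THIS module: reduction only, it instantiates none of them.  NEVER «W-slot closed», NEVER «G-an2-4 closed».  NOT summit progress.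

v1.1 DOCFIX (2026-08-20; orphan adoption by the idle leaf seat `b2b-balaban-gan24-formalise-leaf-01` gen 35 — the author lineage
`b2b-balaban-gan24-formalise-leaf-07` is retired): referee-2 objection G-gan24ref2-4 (GAPS.md, round 49; 22 notices through round 89) — the
module docstring's v1 phrase counting the instantiated wall binders as zero (FALSE since rounds 23/45: the wall's K- and S-pairs ARE tree theorems) is replaced
above by the accounting of record; every declaration of v1 (p210510) is byte-identical, no import change.

## What is proved (generic `d`; `Lc` with `NeZero Lc`, `1 ≤ Lc`)
* bookkeeping: `locStencil₂_le_mono`, `pow_le_pow_of_le_max₃`-type ratio merging (inline).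
* **`hWall_of_shapes`**: `UnitDecayK … C δ → CauchyDecayK … cK θK δ → 0 < δ → 0 ≤ θK < 1 → «E3Shape» C₃ δ₃ → «E3Drift» c₃ θ₃ δ₃ → 0 < θ₃ < 1 →
  0 < δ₃ → «T2Shape» C₂ δ₂ → «T2Drift» c₂ θ₂ δ₂ → 0 < δ₂ → 0 ≤ θ₂ < 1 → LocStencilFM Lc mixFF CM₂ δ₄ → 0 < δ₄ → (mixFF field–field-valued) →
  ∃ cW θW δW, 0 ≤ θW ∧ θW < 1 ∧ 0 < δW ∧ ∀ k j, VertexFamily₂ (unitW_{k+j} (WbalOf … (k+j)) − unitW_k (WbalOf … k)) Lc (cW·θW^k) δW`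
  — LITERALLY the binder `hWall` of `HessKerDressedUnitsWall.d1Drift_JsBalOf_iff_of_cauchy_unit` / `hW₂all` of
  `StencilSlotWallThree.d1Drift_JsBalOf_iff_three_of_wRows` at `sf := sfStep Lc`, `sm := smStep d Lc`, `W := WbalOf d Lc cE cVH cΛ T₂ mixFF`.
* **`hW_hWall_of_shapes`**: both W-rows with ONE common decay rate `δW` (the socket's shape), from the same hypotheses.
-/

noncomputable section

open Literature.MathematicalPhysics.QuantumFieldTheory
open Literature.MathematicalPhysics.QuantumFieldTheory.Balaban1983to89
open Literature.MathematicalPhysics.QuantumFieldTheory.Balaban1983to89.Beta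
open B12Sec2to5 (l1 l1_nonneg)
open ExpKernelCalculus (MKer Decays BiLoc VertexFamily VertexFamily₂ Zl)
open OneStepResolventKernel (Fib LocStencil decays_mono biLoc_mono bound_mono)
open OneStepKernelFamily (KInvStep)
open AveragingHessianKernels (hessFF ell)
open BalabanStepJets (vertexFamily₂_mono)
open BalabanStepJetsSucc (wE e3Of)
open BalabanCompositeJets (LocStencil₂)
open SecondOrderResponse (W2SymOfK LocStencilFM)
open BalabanStepW2 (Spure M1 M2Of WbalOf)
open Summit.QuantumFields.BalabanUV.Beta.HessKerDressedUnits (unitK unitS unitW)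
open Summit.QuantumFields.BalabanUV.Beta.SecondOrderUnits (unitM unitS₂ unitM₂ unitW_WbalOf)
open Summit.QuantumFields.BalabanUV.Beta.GAN24.CombesThomas (sfStep smStep UnitDecayK CauchyDecayK sfStep_ne_zero smStep_ne_zero)
open Summit.QuantumFields.BalabanUV.Beta.GAN24.StencilSlotOfShapes (locStencil_mono')
open Summit.QuantumFields.BalabanUV.Beta.GAN24.WSlotOfShapes (unitM_M1_eq unitM₂_M2Of_eq vertexFamily_smul_hessFF locStencil_unitS_Spure
  hW_of_shapes)
open Summit.QuantumFields.BalabanUV.Beta.GAN24.SpureUnitDrift (spureDrift_of_shapes)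
open Summit.QuantumFields.BalabanUV.Beta.GAN24.SecondOrderLipschitzW2 (LW2 LW2_mul vertexFamily₂_W2SymOfK_sub)

namespace Summit.QuantumFields.BalabanUV.Beta.GAN24.WSlotCauchyOfShapes

variable {d : ℕ} {Lc : ℕ} [NeZero Lc]

/-! ## §1 Bookkeeping -/

omit [NeZero Lc] in
/-- [folklore] A `LocStencil₂` bound weakens to a larger constant and a smaller (nonnegative) rate. -/
theorem locStencil₂_le_mono {S₂ : Fin (d + 1) → (Fin (d + 1) → ℤ) → Fin (d + 1) → (Fin (d + 1) → ℤ) → MKer (d + 1) (Fib d)}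
    {C C' δ δ' : ℝ} (h : LocStencil₂ S₂ C δ) (hCC : C ≤ C') (hδ : δ' ≤ δ) : LocStencil₂ S₂ C' δ' := by
  have hC := h.nonneg
  have h1 := h.mono hδ
  intro κ u κ' u' x z a b
  refine (h1 κ u κ' u' x z a b).trans ?_
  have hE := (Real.exp_pos (-δ' * l1 (u' - u))).le
  have hE2 := (Real.exp_pos (-δ' * (l1 (x - u) + l1 (z - u)))).le
  gcongr

/-- [folklore] The zero table is a vertex family with any nonnegative constant (the multiplier slot does not move along the tower). -/
theorem vertexFamily_zero {N : ℕ} {C δ : ℝ} (hC : 0 ≤ C) :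
    VertexFamily (0 : Fin (d + 1) → (Fin (d + 1) → ℤ) → MKer (d + 1) (Fib d)) N C δ := by
  intro μ y x z a b
  simp only [Pi.zero_apply, abs_zero]
  positivity

/-- [folklore] The zero field–multiplier table is a `LocStencilFM` family with any nonnegative constant (the mixed slot does not move). -/
theorem locStencilFM_zero {N : ℕ} {C δ : ℝ} (hC : 0 ≤ C) :
    LocStencilFM N (0 : Fin (d + 1) → (Fin (d + 1) → ℤ) → Fin (d + 1) → (Fin (d + 1) → ℤ) → MKer (d + 1) (Fib d)) C δ := by
  intro κ u ρ w x z a b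
  simp only [Pi.zero_apply, abs_zero]
  positivity

/-- [folklore] Geometric deviations at a smaller ratio are deviations at a larger ratio: `c·θ^k ≤ c·θ′^k` for `0 ≤ θ ≤ θ′`, `0 ≤ c`. -/
theorem mul_pow_le_mul_pow {c θ θ' : ℝ} (hc : 0 ≤ c) (hθ : 0 ≤ θ) (hθθ : θ ≤ θ') (k : ℕ) : c * θ ^ k ≤ c * θ' ^ k :=
  mul_le_mul_of_nonneg_left (pow_le_pow_left₀ hθ hθθ k) hc

/-! ## §2 The Cauchy half of the W-slot from the located shapes -/

/-- **THE W-SLOT's CAUCHY HALF AS A FUNCTION OF THE K-SLOT, «E3Shape» ∧ «E3Drift», «T2Shape» ∧ «T2Drift» AND THE MIXED-TABLE SHAPE**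
[folklore assembly]: for an2's family `W := WbalOf d Lc cE cVH cΛ T₂ mixFF` in the adopted units, the all-scales deviations of the
normalised members are a `VertexFamily₂` with a GEOMETRIC constant `cW·θW^k` (ratio `θW = max θK (max θ₃ θ₂) < 1`) and one rate — the binder
`hWall` of `HessKerDressedUnitsWall.d1Drift_JsBalOf_iff_of_cauchy_unit` at `sf := sfStep Lc`, `sm := smStep d Lc`.  Route: `unitW_WbalOf` on
both members, the `j`-free slots `unitM_M1_eq` / `unitM₂_M2Of_eq`, then the carrier's Lipschitz estimate `vertexFamily₂_W2SymOfK_sub` ONCE per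
pair `(k+j, k)` at the common rate `m`, deviations `(cK, cS, 0, c₂, 0)·θW^k` (linearity `SecondOrderLipschitzW2.LW2_mul`). -/
theorem hWall_of_shapes (hLc : 1 ≤ Lc) {C δ cK θK : ℝ} (hK : UnitDecayK d Lc (sfStep Lc) (smStep d Lc) C δ)
    (hKall : CauchyDecayK d Lc (sfStep Lc) (smStep d Lc) cK θK δ) (hδ : 0 < δ) (hθK0 : 0 ≤ θK) (hθK1 : θK < 1)
    {cE cVH cΛ C₃ c₃ θ₃ δ₃ : ℝ}
    (hE3 : ∀ j : ℕ, LocStencil (unitS (sfStep Lc (j + 1)) (smStep d Lc (j + 1))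
      (fun κ u => (cE * wE d Lc (j + 1)) • e3Of d Lc cE cVH cΛ (j + 1) κ u)) C₃ δ₃)
    (hE3d : ∀ k j : ℕ, LocStencil (fun κ u =>
        unitS (sfStep Lc (k + j + 1)) (smStep d Lc (k + j + 1))
            (fun κ u => (cE * wE d Lc (k + j + 1)) • e3Of d Lc cE cVH cΛ (k + j + 1) κ u) κ u -
          unitS (sfStep Lc (k + 1)) (smStep d Lc (k + 1))
            (fun κ u => (cE * wE d Lc (k + 1)) • e3Of d Lc cE cVH cΛ (k + 1) κ u) κ u) (c₃ * θ₃ ^ k) δ₃)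
    (hθ₃ : 0 < θ₃) (hθ₃1 : θ₃ < 1) (hδ₃ : 0 < δ₃)
    {T₂ : ℕ → Fin (d + 1) → (Fin (d + 1) → ℤ) → Fin (d + 1) → (Fin (d + 1) → ℤ) → MKer (d + 1) (Fib d)} {C₂ c₂ θ₂ δ₂ : ℝ}
    (hT₂ : ∀ j, LocStencil₂ (unitS₂ (sfStep Lc j) (smStep d Lc j) (T₂ j)) C₂ δ₂)
    (hT₂d : ∀ k j, LocStencil₂ (unitS₂ (sfStep Lc (k + j)) (smStep d Lc (k + j)) (T₂ (k + j)) -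
      unitS₂ (sfStep Lc k) (smStep d Lc k) (T₂ k)) (c₂ * θ₂ ^ k) δ₂)
    (hδ₂ : 0 < δ₂) (hθ₂0 : 0 ≤ θ₂) (hθ₂1 : θ₂ < 1)
    {mixFF : Fin (d + 1) → (Fin (d + 1) → ℤ) → Fin (d + 1) → (Fin (d + 1) → ℤ) → MKer (d + 1) (Fib d)} {CM₂ δ₄ : ℝ}
    (hmix : LocStencilFM Lc mixFF CM₂ δ₄) (hδ₄ : 0 < δ₄)
    (hfm : ∀ κ u ρ w x z (α μ' : Fin (d + 1)), mixFF κ u ρ w x z (Sum.inl α) (Sum.inr μ') = 0)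
    (hm : ∀ κ u ρ w x z (μ' : Fin (d + 1)) (b : Fib d), mixFF κ u ρ w x z (Sum.inr μ') b = 0) :
    ∃ cW θW δW : ℝ, 0 ≤ θW ∧ θW < 1 ∧ 0 < δW ∧
      ∀ k j, VertexFamily₂ (unitW (sfStep Lc (k + j)) (smStep d Lc (k + j)) (WbalOf d Lc cE cVH cΛ T₂ mixFF (k + j)) -
        unitW (sfStep Lc k) (smStep d Lc k) (WbalOf d Lc cE cVH cΛ T₂ mixFF k)) Lc (cW * θW ^ k) δW := by
  -- the normalised first field table: uniform shape and geometric drift (leaf-07 / leaf-10, from «E3Shape» ∧ «E3Drift»)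
  obtain ⟨Cs, δs, hδs, hS⟩ := locStencil_unitS_Spure (d := d) (Lc := Lc) hLc hE3 hδ₃
  obtain ⟨cS, δS, hδS, hSd⟩ := spureDrift_of_shapes (d := d) (Lc := Lc) hLc hθ₃ hE3 hE3d hδ₃
  -- nonnegativity of the data constants
  have hC : 0 ≤ C := (hK 0).nonneg (Sum.inl 0)
  have hcK : 0 ≤ cK := by have h := (hKall 0 0).nonneg (Sum.inl 0); simpa using h
  have hCs : 0 ≤ Cs := ((hS 0) 0 0).nonneg (Sum.inl 0)
  have hcS : 0 ≤ cS := by have h := ((hSd 0 0) 0 0).nonneg (Sum.inl 0); simpa using h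
  have hC₂ : 0 ≤ C₂ := (hT₂ 0).nonneg
  have hc₂ : 0 ≤ c₂ := by have h := (hT₂d 0 0).nonneg; simpa using h
  have hCM₂ : 0 ≤ CM₂ := hmix.nonneg
  -- the common ratio and the common rate
  set θW : ℝ := max θK (max θ₃ θ₂) with hθW_def
  have hθW0 : 0 ≤ θW := hθK0.trans (le_max_left _ _)
  have hθW1 : θW < 1 := max_lt hθK1 (max_lt hθ₃1 hθ₂1)
  have hKW : θK ≤ θW := le_max_left _ _
  have h3W : θ₃ ≤ θW := (le_max_left _ _).trans (le_max_right _ _)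
  have h2W : θ₂ ≤ θW := (le_max_right _ _).trans (le_max_right _ _)
  set m : ℝ := min δ (min δs (min δS (min δ₂ δ₄))) with hm_def
  have hm0 : 0 < m := lt_min hδ (lt_min hδs (lt_min hδS (lt_min hδ₂ hδ₄)))
  have hmδ : m ≤ δ := min_le_left _ _
  have hms : m ≤ δs := (min_le_right _ _).trans (min_le_left _ _)
  have hmS : m ≤ δS := (min_le_right _ _).trans ((min_le_right _ _).trans (min_le_left _ _))
  have hm2 : m ≤ δ₂ := (min_le_right _ _).trans ((min_le_right _ _).trans ((min_le_right _ _).trans (min_le_left _ _)))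
  have hm4 : m ≤ δ₄ := (min_le_right _ _).trans ((min_le_right _ _).trans ((min_le_right _ _).trans (min_le_right _ _)))
  -- the `j`-free multiplier table at the common rate
  set CM : ℝ := |cΛ| * (2 * (ell (d + 1) Lc : ℝ) ^ 2 * Real.exp (4 * ((d : ℝ) + 1) * Lc * m)) with hCM_def
  have hM : VertexFamily (fun ρ w => cΛ • hessFF (d := d) Lc ρ w) Lc CM m := vertexFamily_smul_hessFF hLc cΛ hm0.le
  have hmixm : LocStencilFM Lc mixFF CM₂ m := hmix.mono hm4
  refine ⟨LW2 d C Cs CM C₂ CM₂ cK cS 0 c₂ 0 m, θW, m / 16, hθW0, hθW1, by positivity, fun k j => ?_⟩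
  -- the data of the pair `(k+j, k)` at the common rate and the common ratio
  have hK1 : Decays (unitK (sfStep Lc (k + j)) (smStep d Lc (k + j)) (KInvStep (d := d) Lc (k + j))) C m :=
    decays_mono (hK (k + j)) hC le_rfl hmδ
  have hK0 : Decays (unitK (sfStep Lc k) (smStep d Lc k) (KInvStep (d := d) Lc k)) C m := decays_mono (hK k) hC le_rfl hmδ
  have hKK : Decays (unitK (sfStep Lc (k + j)) (smStep d Lc (k + j)) (KInvStep (d := d) Lc (k + j)) -
      unitK (sfStep Lc k) (smStep d Lc k) (KInvStep (d := d) Lc k)) (cK * θW ^ k) m :=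
    decays_mono (hKall k j) (by positivity) (mul_pow_le_mul_pow hcK hθK0 hKW k) hmδ
  have hS1 : LocStencil (unitS (sfStep Lc (k + j)) (smStep d Lc (k + j)) (Spure d Lc cE cVH cΛ (k + j))) Cs m :=
    locStencil_mono' (hS (k + j)) le_rfl hms
  have hS0 : LocStencil (unitS (sfStep Lc k) (smStep d Lc k) (Spure d Lc cE cVH cΛ k)) Cs m := locStencil_mono' (hS k) le_rfl hms
  have hSS : LocStencil (unitS (sfStep Lc (k + j)) (smStep d Lc (k + j)) (Spure d Lc cE cVH cΛ (k + j)) -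
      unitS (sfStep Lc k) (smStep d Lc k) (Spure d Lc cE cVH cΛ k)) (cS * θW ^ k) m :=
    locStencil_mono' (hSd k j) (mul_pow_le_mul_pow hcS hθ₃.le h3W k) hmS
  have hT1 : LocStencil₂ (unitS₂ (sfStep Lc (k + j)) (smStep d Lc (k + j)) (T₂ (k + j))) C₂ m :=
    locStencil₂_le_mono (hT₂ (k + j)) le_rfl hm2
  have hT0 : LocStencil₂ (unitS₂ (sfStep Lc k) (smStep d Lc k) (T₂ k)) C₂ m := locStencil₂_le_mono (hT₂ k) le_rfl hm2
  have hTT : LocStencil₂ (unitS₂ (sfStep Lc (k + j)) (smStep d Lc (k + j)) (T₂ (k + j)) - unitS₂ (sfStep Lc k) (smStep d Lc k) (T₂ k))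
      (c₂ * θW ^ k) m := locStencil₂_le_mono (hT₂d k j) (mul_pow_le_mul_pow hc₂ hθ₂0 h2W k) hm2
  -- the multiplier and mixed slots do not move: zero deviations
  have hθk : (0 : ℝ) ≤ 0 * θW ^ k := by positivity
  have hMM : VertexFamily ((fun ρ w => cΛ • hessFF (d := d) Lc ρ w) - fun ρ w => cΛ • hessFF (d := d) Lc ρ w) Lc (0 * θW ^ k) m := by
    rw [sub_self]; exact vertexFamily_zero hθk
  have hMM₂ : LocStencilFM Lc (mixFF - mixFF) (0 * θW ^ k) m := by
    rw [sub_self]; exact locStencilFM_zero hθk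
  -- rewrite both members as the carrier over the normalised data; the multiplier and mixed slots are `j`-free
  rw [unitW_WbalOf d Lc (sfStep_ne_zero (k + j)) (smStep_ne_zero (k + j)), unitW_WbalOf d Lc (sfStep_ne_zero k) (smStep_ne_zero k),
    unitM_M1_eq, unitM_M1_eq, unitM₂_M2Of_eq hfm hm, unitM₂_M2Of_eq hfm hm]
  have h := vertexFamily₂_W2SymOfK_sub (N := Lc) hK1 hK0 hKK hm0 hS1 hS0 hSS hM hM hMM hT1 hT0 hTT hmixm hmixm hMM₂
  rw [LW2_mul] at h
  exact h

/-- **BOTH W-ROWS OF THE WALL FOR an2's FAMILY, AT ONE COMMON DECAY RATE** (the socket's shape: `hW` and `hWall` share `δW`): from the same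
located shapes; `hW` by `WSlotOfShapes.hW_of_shapes`, `hWall` by `hWall_of_shapes`, rates merged by monotonicity. -/
theorem hW_hWall_of_shapes (hLc : 1 ≤ Lc) {C δ cK θK : ℝ} (hK : UnitDecayK d Lc (sfStep Lc) (smStep d Lc) C δ)
    (hKall : CauchyDecayK d Lc (sfStep Lc) (smStep d Lc) cK θK δ) (hδ : 0 < δ) (hθK0 : 0 ≤ θK) (hθK1 : θK < 1)
    {cE cVH cΛ C₃ c₃ θ₃ δ₃ : ℝ}
    (hE3 : ∀ j : ℕ, LocStencil (unitS (sfStep Lc (j + 1)) (smStep d Lc (j + 1))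
      (fun κ u => (cE * wE d Lc (j + 1)) • e3Of d Lc cE cVH cΛ (j + 1) κ u)) C₃ δ₃)
    (hE3d : ∀ k j : ℕ, LocStencil (fun κ u =>
        unitS (sfStep Lc (k + j + 1)) (smStep d Lc (k + j + 1))
            (fun κ u => (cE * wE d Lc (k + j + 1)) • e3Of d Lc cE cVH cΛ (k + j + 1) κ u) κ u -
          unitS (sfStep Lc (k + 1)) (smStep d Lc (k + 1))
            (fun κ u => (cE * wE d Lc (k + 1)) • e3Of d Lc cE cVH cΛ (k + 1) κ u) κ u) (c₃ * θ₃ ^ k) δ₃)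
    (hθ₃ : 0 < θ₃) (hθ₃1 : θ₃ < 1) (hδ₃ : 0 < δ₃)
    {T₂ : ℕ → Fin (d + 1) → (Fin (d + 1) → ℤ) → Fin (d + 1) → (Fin (d + 1) → ℤ) → MKer (d + 1) (Fib d)} {C₂ c₂ θ₂ δ₂ : ℝ}
    (hT₂ : ∀ j, LocStencil₂ (unitS₂ (sfStep Lc j) (smStep d Lc j) (T₂ j)) C₂ δ₂)
    (hT₂d : ∀ k j, LocStencil₂ (unitS₂ (sfStep Lc (k + j)) (smStep d Lc (k + j)) (T₂ (k + j)) -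
      unitS₂ (sfStep Lc k) (smStep d Lc k) (T₂ k)) (c₂ * θ₂ ^ k) δ₂)
    (hδ₂ : 0 < δ₂) (hθ₂0 : 0 ≤ θ₂) (hθ₂1 : θ₂ < 1)
    {mixFF : Fin (d + 1) → (Fin (d + 1) → ℤ) → Fin (d + 1) → (Fin (d + 1) → ℤ) → MKer (d + 1) (Fib d)} {CM₂ δ₄ : ℝ}
    (hmix : LocStencilFM Lc mixFF CM₂ δ₄) (hδ₄ : 0 < δ₄)
    (hfm : ∀ κ u ρ w x z (α μ' : Fin (d + 1)), mixFF κ u ρ w x z (Sum.inl α) (Sum.inr μ') = 0)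
    (hm : ∀ κ u ρ w x z (μ' : Fin (d + 1)) (b : Fib d), mixFF κ u ρ w x z (Sum.inr μ') b = 0) :
    ∃ Cw cW θW δW : ℝ, 0 ≤ θW ∧ θW < 1 ∧ 0 < δW ∧
      (∀ j, VertexFamily₂ (unitW (sfStep Lc j) (smStep d Lc j) (WbalOf d Lc cE cVH cΛ T₂ mixFF j)) Lc Cw δW) ∧
      (∀ k j, VertexFamily₂ (unitW (sfStep Lc (k + j)) (smStep d Lc (k + j)) (WbalOf d Lc cE cVH cΛ T₂ mixFF (k + j)) -
        unitW (sfStep Lc k) (smStep d Lc k) (WbalOf d Lc cE cVH cΛ T₂ mixFF k)) Lc (cW * θW ^ k) δW) := by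
  obtain ⟨Cw, δ₁, hδ₁, hW⟩ := hW_of_shapes (d := d) (Lc := Lc) hLc hK hδ hE3 hδ₃ hT₂ hδ₂ hmix hδ₄ hfm hm
  obtain ⟨cW, θW, δ₅, hθW0, hθW1, hδ₅, hWall⟩ :=
    hWall_of_shapes (d := d) (Lc := Lc) hLc hK hKall hδ hθK0 hθK1 hE3 hE3d hθ₃ hθ₃1 hδ₃ hT₂ hT₂d hδ₂ hθ₂0 hθ₂1 hmix hδ₄ hfm hm
  have hCw : 0 ≤ Cw := ((hW 0) 0 0 0 0).nonneg (Sum.inl 0)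
  have hcW : 0 ≤ cW := by have h := ((hWall 0 0) 0 0 0 0).nonneg (Sum.inl 0); simpa using h
  refine ⟨Cw, cW, θW, min δ₁ δ₅, hθW0, hθW1, lt_min hδ₁ hδ₅, fun j => vertexFamily₂_mono (hW j) hCw (min_le_left _ _), fun k j =>
    vertexFamily₂_mono (hWall k j) (by positivity) (min_le_right _ _)⟩

end Summit.QuantumFields.BalabanUV.Beta.GAN24.WSlotCauchyOfShapes

end
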